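/-
Copyright: the b2b-balaban T⁴-continuum CRUX team, row NE7b OWNER lineage `t4-ne7b-p1` (gen 144). Project licence.
-/
import Summits.QuantumFields.BalabanUV.T4Continuum.Spine.NE7b.SupBlockFifthKernelAverage
import Summits.QuantumFields.BalabanUV.T4Continuum.Spine.NE7b.SupWhitenedFifthThreePointRowLetters
import Summits.QuantumFields.BalabanUV.T4Continuum.Spine.NE7b.SupWhitenedFourthKernelEntry
import Summits.QuantumFields.BalabanUV.T4Continuum.Spine.NE7b.SupFourthKernelEntryPieces

/-!
# ENTRY PIECES FOR THE ORDER-FIVE ENTRY MAJORANT, I (the order-5 block of the kernel-letter CLASS MAP, first file; the analogue of (525)∕(526)'s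
# inputs).  To re-enter the input format `|U⁽⁵⁾(φ)[e_u,e_x,e_y,e_z,e_t]| ≤ K5_{xyztu}`, the fifth derivative ((591)–(594): 52 placements) needs
# a BACKGROUND-FREE entrywise bound for every placement.  This file: (§1) the average entry `|⟨U⁽⁵⁾xyzts⟩| ≤ K5_{yztsx}` (general `Γ ⪰ 0`; (525)'s
# proof one order up); (§2) the four centred-triple placements ((567)∕(568)∕(570)∕(571), Gaussian tilted format) with their decay constants
# replaced by LETTERS `C3k ≥ 4√(M_C K)`, `C3h ≥ 4√(M_B K)` and improved to ZERO off the support of the third majorant `K3` (pair riding on the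
# vertex) resp. of the Hessian majorant `Hk` (both Hessian partners) by (575) `third_entry_vanishes` ∕ (511) `hessian_entry_vanishes` and (526)
# `abs_le_ite_of_vanishing` — the indicators keep the fixed-slot sums volume-uniform (row NE7b, node U5c; (580), (567), (568), (570), (571),
# (575), (511), (526) BY NAME; [folklore])

Cell `pub-balaban`, sub-cell `t4`, spine estimate NE7b (`T4WeightBudget.RelWeightBound`; the cell's OWN estimate — NOT PRINTED in
[Bałaban 1983–89], NOT PROVED).  Crux-route work under `Spine/NE7b/` by the row OWNER (`t4-ne7b-p1` gen 144, file (603)) under FREEZE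
(0)'s crux-prover clause; NOTHING of Bałaban's is named as a Lean object, valued or asserted; no `T4Continuum/Support` leaf typed; no
`def`, no notation (every cumulant WRITTEN OUT); zero `sorry`.  Imports (BY NAME): the OWNER's (580), (575) (through it (567)∕(568)∕(570)∕(571)),
(526), (525).

WHAT IS PROVED ([folklore]): §1 `tilted_fifth_average_entry`; §2 `third_gradgrad_entry_ite`, `third_gradgrad_entry_two_ite`,
`hesshess_grad_entry_ite`,
`hesshess_grad_entry_two_ite`; §3 toy.

HONEST (what this is NOT).  Entry bounds; the `u₄`∕`u₅` entries in the tilted format, the two-point entries ((562)∕(563), already tilted), the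
group entry majorants, the five fixed-slot letters and the packaging are the next files.  Scalar skeleton ((A3), NC-NE7b-α UNRULED); nothing of
Bałaban's asserted.  BY-NAME EFFECT ON THE WALL: NONE.  NE7b NOT PRINTED ∕ NOT
PROVED; spine PROVED 0∕9; rung (B)+1 — the programme's measures remain FINITE-torus statements; NOT the mass gap, NOT Clay.  HONEST DEPENDENCY:
continuum YM on T⁴ ⇐ BetaPertH ∧ nine spine estimates (0∕9 proved); BetaPertH ⇐ (D1) ∧ (D4) ∧ CAP+tail; G-an2-4 gates asym, D1 and NE2∕3∕4.
-/

set_option autoImplicit false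
set_option maxSynthPendingDepth 4

noncomputable section

namespace Summit.QuantumFields.BalabanUV.T4Continuum.NE7b.SupFifthKernelEntryPieces

open MeasureTheory ProbabilityTheory Finset Real Matrix
open scoped BigOperators Matrix
open SupEffectiveActionDerivative (mul_opBound_le_of_le)
open SupBlockEffectiveActionDerivative (integrable_exp_neg_block)
open SupBlockDressedStep (block_Z_pos)
open SupBlockHessianKernelAverage (rowsum_of_weighted_average)
open SupBlockFifthKernelAverage (integrable_weighted_fifth_entry)
open SupWhitenedThirdGradGradCumulantEntry (whitened_third_gradgrad_entry)
open SupWhitenedThirdGradGradCumulantEntryTwo (whitened_third_gradgrad_entry_two)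
open SupWhitenedHessHessGradCumulantEntry (whitened_hesshess_grad_entry)
open SupWhitenedHessHessGradCumulantEntryTwo (whitened_hesshess_grad_entry_two)
open SupWhitenedFifthThreePointRowLetters (third_entry_vanishes)
open SupWhitenedMixedThreePointRowLetters (hessian_entry_vanishes)
open SupWhitenedFourthKernelEntry (abs_le_ite_of_vanishing)

variable {ι κ : Type} [Fintype ι] [DecidableEq ι] [Fintype κ] [DecidableEq κ]

variable {U : EuclideanSpace ℝ ι → ℝ} {U' : EuclideanSpace ℝ ι → EuclideanSpace ℝ ι →L[ℝ] ℝ}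
  {U'' : EuclideanSpace ℝ ι → EuclideanSpace ℝ ι →L[ℝ] EuclideanSpace ℝ ι →L[ℝ] ℝ}
  {U₃ : EuclideanSpace ℝ ι → EuclideanSpace ℝ ι →L[ℝ] EuclideanSpace ℝ ι →L[ℝ] EuclideanSpace ℝ ι →L[ℝ] ℝ}
  {U₄ : EuclideanSpace ℝ ι → EuclideanSpace ℝ ι →L[ℝ] EuclideanSpace ℝ ι →L[ℝ] EuclideanSpace ℝ ι →L[ℝ] EuclideanSpace ℝ ι →L[ℝ] ℝ}
  {U₅ : EuclideanSpace ℝ ι →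
    EuclideanSpace ℝ ι →L[ℝ] EuclideanSpace ℝ ι →L[ℝ] EuclideanSpace ℝ ι →L[ℝ] EuclideanSpace ℝ ι →L[ℝ] EuclideanSpace ℝ ι →L[ℝ] ℝ}
  {Hk : ι → ι → ℝ} {K3 : ι → ι → ι → ℝ} {K4 : ι → ι → ι → ι → ℝ} {K5 : ι → ι → ι → ι → ι → ℝ} {A : Matrix ι κ ℝ} {D : κ → κ → ℝ}
  {γop κ₀ κ₁ κ₂ κ₃ κ₄ κ₅ κ₅r a τ δ θp lam lamA αr αc hr hc k3r k3c k4r k4c k5r k5c γ dr dc dθ dθ' αθ βθ S S' S₁ n₃ : ℝ} {θ : κ → κ → ℝ}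
  {σ : ι → κ → ℝ} {ρ r : ι → ι → ℝ} {Γ : Matrix ι ι ℝ} {C3k C3h C4 C5 : ℝ}


/-! ## §1. The average entry (general `Γ ⪰ 0`) -/

omit [Fintype κ] [DecidableEq κ] in
set_option synthInstance.maxHeartbeats 200000 in
/-- **THE AVERAGE ENTRY** (general `Γ ⪰ 0`): `|Z⁻¹∫e^{−U(ω+ψ)}U⁽⁵⁾(ω+ψ)[e_x,e_y,e_z,e_t,e_s]dN(0,Γ)| ≤ K5_{yztsx}` for an entrywise majorant
`|U⁽⁵⁾(φ)[e_u,e_x,e_y,e_z,e_t]| ≤ K5_{xyztu}` (a weighted average is at most the sup; (437) on the one-point index). [folklore] -/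
theorem tilted_fifth_average_entry (hΓ : Γ.PosSemidef) (hΓop : (γop • (1 : Matrix ι ι ℝ) - Γ).PosSemidef) (Y : Finset ι)
    (hUd : ∀ φ : EuclideanSpace ℝ ι, HasFDerivAt U (U' φ) φ) (hU₅c : Continuous U₅) (hκ₀ : 0 ≤ κ₀) (hτ : 0 < τ) (hδ : 0 < δ) (hθ0 : 0 < θp)
    (hθ1 : θp < 1) (hκθ : (2 * κ₀ * (1 + τ) + 4 * δ) * γop ≤ θp) (hstab : ∀ φ : EuclideanSpace ℝ ι, -(κ₀ * ∑ x ∈ Y, φ x ^ 2) ≤ U φ)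
    (hU₅b : ∀ φ : EuclideanSpace ℝ ι, ‖U₅ φ‖ ≤ κ₅)
    (hK5 : ∀ (φ : EuclideanSpace ℝ ι) (u x y z t : ι), |U₅ φ (EuclideanSpace.single u (1 : ℝ)) (EuclideanSpace.single x (1 : ℝ))
      (EuclideanSpace.single y (1 : ℝ)) (EuclideanSpace.single z (1 : ℝ)) (EuclideanSpace.single t (1 : ℝ))| ≤ K5 x y z t u)
    (ψ : EuclideanSpace ℝ ι) (x y z t s : ι) :
    |((∫ ω : EuclideanSpace ℝ ι, exp (-U (ω + ψ)) ∂(multivariateGaussian 0 Γ))⁻¹ * (∫ ω : EuclideanSpace ℝ ι, exp (-U (ω + ψ)) * U₅ (ω + ψ)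
        (EuclideanSpace.single x (1 : ℝ)) (EuclideanSpace.single y (1 : ℝ)) (EuclideanSpace.single z (1 : ℝ)) (EuclideanSpace.single t (1 : ℝ))
        (EuclideanSpace.single s (1 : ℝ)) ∂(multivariateGaussian 0 Γ)))| ≤ K5 y z t s x := by
  have hUc : Continuous U := continuous_iff_continuousAt.2 fun φ => (hUd φ).continuousAt
  have hκθ₀ : 2 * κ₀ * (1 + τ) * γop ≤ θp := mul_opBound_le_of_le (by positivity) (by linarith) hθ0.le hκθ
  have hI := integrable_exp_neg_block hΓ hΓop Y hUc.measurable hκ₀ hτ hθ1 hκθ₀ hstab ψ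
  have hZ := block_Z_pos hΓ hΓop Y hUd hκ₀ hτ hδ hθ0 hθ1 hκθ hstab ψ
  have hint := integrable_weighted_fifth_entry hΓ hΓop Y hUd hU₅c hκ₀ hτ hδ hθ0 hθ1 hκθ hstab hU₅b ψ x y z t s
  have h := rowsum_of_weighted_average (multivariateGaussian 0 Γ) (fun ω : EuclideanSpace ℝ ι => exp (-U (ω + ψ)))
    (fun (ω : EuclideanSpace ℝ ι) (_ : Unit) (_ : Unit) => U₅ (ω + ψ) (EuclideanSpace.single x (1 : ℝ)) (EuclideanSpace.single y (1 : ℝ))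
        (EuclideanSpace.single z (1 : ℝ)) (EuclideanSpace.single t (1 : ℝ)) (EuclideanSpace.single s (1 : ℝ)))
    (fun ω => (exp_pos _).le) hI hZ (fun _ _ => hint) (fun ω _ => by simpa using hK5 (ω + ψ) x y z t s) ()
  simpa using h

/-! ## §2. The centred-triple entries with support indicators and letter constants -/

set_option maxHeartbeats 400000 in
/-- **`κ₃ᶜ(U‴xyz, U′t, U′s)` with the support indicator of `K3` and the letter `C3k ≥ 4√(M_C K)`**: zero unless `(y,z)` is in the third majorant's
range of `x`; else star decay from `x` to `t, s`. [folklore] -/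
theorem third_gradgrad_entry_ite [Nonempty κ]
    (hΓop : (γop • (1 : Matrix ι ι ℝ) - A * Aᵀ).PosSemidef) (Y : Finset ι) (hUd : ∀ φ : EuclideanSpace ℝ ι, HasFDerivAt U (U' φ) φ)
    (hU'd : ∀ φ : EuclideanSpace ℝ ι, HasFDerivAt U' (U'' φ) φ) (hU''d : ∀ φ : EuclideanSpace ℝ ι, HasFDerivAt U'' (U₃ φ) φ)
    (hU₃d : ∀ φ : EuclideanSpace ℝ ι, HasFDerivAt U₃ (U₄ φ) φ) (hU₄c : Continuous U₄) (hκ₀ : 0 ≤ κ₀) (hκ₁ : 0 ≤ κ₁) (ha : 0 ≤ a) (hτ : 0 < τ)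
    (hδ : 0 < δ) (hθ0 : 0 < θp) (hθ1 : θp < 1) (hκθ : (2 * κ₀ * (1 + τ) + 4 * δ) * γop ≤ θp) (hκθw : 2 * κ₀ * (1 + τ) * γop + 4 * δ ≤ θp)
    (hstab : ∀ φ : EuclideanSpace ℝ ι, -(κ₀ * ∑ x ∈ Y, φ x ^ 2) ≤ U φ) (hU'b : ∀ φ : EuclideanSpace ℝ ι, ‖U' φ‖ ≤ κ₁ * (a + ∑ x ∈ Y, φ x ^ 2))
    (hU''b : ∀ φ : EuclideanSpace ℝ ι, ‖U'' φ‖ ≤ κ₂) (hU₃b : ∀ φ : EuclideanSpace ℝ ι, ‖U₃ φ‖ ≤ κ₃) (hU₄b : ∀ φ : EuclideanSpace ℝ ι, ‖U₄ φ‖ ≤ κ₄)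
    (hlam : 0 ≤ lam)
    (hUsec : ∀ s : ℝ, 0 ≤ s → s ≤ 1 → ∀ a b : EuclideanSpace ℝ ι, U ((1 - s) • a + s • b) - lam / 2 * (s * (1 - s)) * ∑ i, (a i - b i) ^ 2 ≤ (1 - s) *
      U a + s * U b)
    (hρg : lam * γop < 1)
    (hHk : ∀ (φ : EuclideanSpace ℝ ι) (x z : ι), |U'' φ (EuclideanSpace.single z (1 : ℝ)) (EuclideanSpace.single x (1 : ℝ))| ≤ Hk x z)
    (hHk0 : ∀ v u, 0 ≤ Hk v u)
    (hK4 : ∀ (φ : EuclideanSpace ℝ ι) (u x y z : ι), |U₄ φ (EuclideanSpace.single u (1 : ℝ)) (EuclideanSpace.single x (1 : ℝ)) (EuclideanSpace.single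
      y (1 : ℝ)) (EuclideanSpace.single z (1 : ℝ))| ≤ K4 x y z u)
    (ψ : EuclideanSpace ℝ ι) (hK40 : ∀ x y z u, 0 ≤ K4 x y z u) (hαr : ∀ u, ∑ w, |A u w| ≤ αr) (hαc : ∀ w, ∑ u, |A u w| ≤ αc)
    (hhr : ∀ v, ∑ u, Hk v u ≤ hr) (hlamA : ∀ x : κ, ∑ u, ∑ v, |A u x| * |A v x| * Hk v u ≤ lamA) (hlamA1 : lamA < 1)
    (hγ : αc * hr * αr / (1 - lamA) ≤ γ) (hγ1 : γ < 1) (hD : ∀ x y, 0 ≤ D x y)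
    (hDC : ∀ x y, (if x = y then (1 : ℝ) else 0) + ∑ z, D x z * ((if y = z then 0 else ∑ u, ∑ v, |A u y| * |A v z| * Hk v u) / (1 - lamA)) ≤ D x y)
    (hθnn : ∀ z w, 0 ≤ θ z w) (hDr : ∀ z, ∑ w, D z w * θ z w ≤ dθ) (hdθ : 0 ≤ dθ) (hDc : ∀ w, ∑ z, D z w * θ z w ≤ dθ') (hdθ' : 0 ≤ dθ')
    (hσ0 : ∀ x w, 0 ≤ σ x w) (hσθ : ∀ x z w, σ x w ≤ σ x z * θ z w) (hρ1 : ∀ x y, 1 ≤ ρ x y) (hρsymm : ∀ x y, ρ x y = ρ y x)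
    (hρmul : ∀ x y z, ρ x z ≤ ρ x y * ρ y z) (hρσ : ∀ x y w, ρ x y ^ 8 ≤ σ x w * σ y w) (haσ : ∀ v : ι, ∑ w, (∑ u, |A u w| * Hk v u) * σ v w ≤ αθ)
    (hβ : 0 ≤ βθ) (haσ' : ∀ (v : ι) (w : κ), (∑ u, |A u w| * Hk v u) * σ v w ≤ βθ) (hkσ : ∀ p q o : ι, ∑ w, (∑ u, |A u w| * K4 p q o u) * σ p w ≤ αθ)
    (hkσ' : ∀ (p q o : ι) (w : κ), (∑ u, |A u w| * K4 p q o u) * σ p w ≤ βθ)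
    (hK3 : ∀ (φ : EuclideanSpace ℝ ι) (u x y : ι), |U₃ φ (EuclideanSpace.single u (1 : ℝ)) (EuclideanSpace.single x (1 : ℝ)) (EuclideanSpace.single y
      (1 : ℝ))| ≤ K3 x y u)
    (hC3k : 4 * Real.sqrt ((5 * ((κ₂ ^ 4 + κ₄ ^ 4) * γop ^ 2) / (1 - lam * γop) ^ 2) * (αθ * dθ * (βθ * dθ') / (1 - lamA))) ≤ C3k) (x y z t s : ι) :
    |((∫ ω : EuclideanSpace ℝ ι, exp (-U (ω + ψ)) ∂(multivariateGaussian 0 (A * Aᵀ)))⁻¹ * (∫ ω : EuclideanSpace ℝ ι, exp (-U (ω + ψ)) * ((U₃ (ω + ψ)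
        (EuclideanSpace.single x (1 : ℝ)) (EuclideanSpace.single y (1 : ℝ)) (EuclideanSpace.single z (1 : ℝ)) - ((∫ ω : EuclideanSpace ℝ ι, exp (-U
        (ω + ψ)) ∂(multivariateGaussian 0 (A * Aᵀ)))⁻¹ * (∫ ω : EuclideanSpace ℝ ι, exp (-U (ω + ψ)) * U₃ (ω + ψ) (EuclideanSpace.single x (1 : ℝ))
        (EuclideanSpace.single y (1 : ℝ)) (EuclideanSpace.single z (1 : ℝ)) ∂(multivariateGaussian 0 (A * Aᵀ))))) * (U' (ω + ψ)
        (EuclideanSpace.single t (1 : ℝ)) - ((∫ ω : EuclideanSpace ℝ ι, exp (-U (ω + ψ)) ∂(multivariateGaussian 0 (A * Aᵀ)))⁻¹ * (∫ ω :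
        EuclideanSpace ℝ ι, exp (-U (ω + ψ)) * U' (ω + ψ) (EuclideanSpace.single t (1 : ℝ)) ∂(multivariateGaussian 0 (A * Aᵀ))))) * (U' (ω + ψ)
        (EuclideanSpace.single s (1 : ℝ)) - ((∫ ω : EuclideanSpace ℝ ι, exp (-U (ω + ψ)) ∂(multivariateGaussian 0 (A * Aᵀ)))⁻¹ * (∫ ω :
        EuclideanSpace ℝ ι, exp (-U (ω + ψ)) * U' (ω + ψ) (EuclideanSpace.single s (1 : ℝ)) ∂(multivariateGaussian 0 (A * Aᵀ))))))
        ∂(multivariateGaussian 0 (A * Aᵀ))))| ≤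
      if K3 y z x = 0 then 0 else C3k / (ρ x t * ρ x s) := by
  refine abs_le_ite_of_vanishing (((whitened_third_gradgrad_entry hΓop Y hUd hU'd hU''d hU₃d hU₄c hκ₀ hκ₁ ha hτ hδ hθ0 hθ1 hκθ hκθw hstab hU'b hU''b
      hU₃b hU₄b hlam hUsec hρg hHk hHk0 hK4 ψ hK40 hαr hαc hhr hlamA hlamA1 hγ hγ1 hD hDC hθnn hDr hdθ hDc hdθ' hσ0 hσθ hρ1 hρsymm hρmul hρσ haσ hβ
      haσ' hkσ hkσ' x y z t s).trans
      (div_le_div_of_nonneg_right hC3k (mul_pos (by linarith [hρ1 x t]) (by linarith [hρ1 x s])).le))) ?_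
  · intro h0
    have hv := fun φ => third_entry_vanishes hK3 (a := x) (b := y) (c := z) h0 φ
    simp [hv]

set_option maxHeartbeats 400000 in
/-- **`κ₃ᶜ(U′x, U‴yzt, U′s)` with the support indicator of `K3` and the letter `C3k`**: zero unless `(z,t)` is in the range of `y`; else star decay
from `x` to `y, s`. [folklore] -/
theorem third_gradgrad_entry_two_ite [Nonempty κ]
    (hΓop : (γop • (1 : Matrix ι ι ℝ) - A * Aᵀ).PosSemidef) (Y : Finset ι) (hUd : ∀ φ : EuclideanSpace ℝ ι, HasFDerivAt U (U' φ) φ)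
    (hU'd : ∀ φ : EuclideanSpace ℝ ι, HasFDerivAt U' (U'' φ) φ) (hU''d : ∀ φ : EuclideanSpace ℝ ι, HasFDerivAt U'' (U₃ φ) φ)
    (hU₃d : ∀ φ : EuclideanSpace ℝ ι, HasFDerivAt U₃ (U₄ φ) φ) (hU₄c : Continuous U₄) (hκ₀ : 0 ≤ κ₀) (hκ₁ : 0 ≤ κ₁) (ha : 0 ≤ a) (hτ : 0 < τ)
    (hδ : 0 < δ) (hθ0 : 0 < θp) (hθ1 : θp < 1) (hκθ : (2 * κ₀ * (1 + τ) + 4 * δ) * γop ≤ θp) (hκθw : 2 * κ₀ * (1 + τ) * γop + 4 * δ ≤ θp)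
    (hstab : ∀ φ : EuclideanSpace ℝ ι, -(κ₀ * ∑ x ∈ Y, φ x ^ 2) ≤ U φ) (hU'b : ∀ φ : EuclideanSpace ℝ ι, ‖U' φ‖ ≤ κ₁ * (a + ∑ x ∈ Y, φ x ^ 2))
    (hU''b : ∀ φ : EuclideanSpace ℝ ι, ‖U'' φ‖ ≤ κ₂) (hU₃b : ∀ φ : EuclideanSpace ℝ ι, ‖U₃ φ‖ ≤ κ₃) (hU₄b : ∀ φ : EuclideanSpace ℝ ι, ‖U₄ φ‖ ≤ κ₄)
    (hlam : 0 ≤ lam)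
    (hUsec : ∀ s : ℝ, 0 ≤ s → s ≤ 1 → ∀ a b : EuclideanSpace ℝ ι, U ((1 - s) • a + s • b) - lam / 2 * (s * (1 - s)) * ∑ i, (a i - b i) ^ 2 ≤ (1 - s) *
      U a + s * U b)
    (hρg : lam * γop < 1)
    (hHk : ∀ (φ : EuclideanSpace ℝ ι) (x z : ι), |U'' φ (EuclideanSpace.single z (1 : ℝ)) (EuclideanSpace.single x (1 : ℝ))| ≤ Hk x z)
    (hHk0 : ∀ v u, 0 ≤ Hk v u)
    (hK4 : ∀ (φ : EuclideanSpace ℝ ι) (u x y z : ι), |U₄ φ (EuclideanSpace.single u (1 : ℝ)) (EuclideanSpace.single x (1 : ℝ)) (EuclideanSpace.single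
      y (1 : ℝ)) (EuclideanSpace.single z (1 : ℝ))| ≤ K4 x y z u)
    (ψ : EuclideanSpace ℝ ι) (hK40 : ∀ x y z u, 0 ≤ K4 x y z u) (hαr : ∀ u, ∑ w, |A u w| ≤ αr) (hαc : ∀ w, ∑ u, |A u w| ≤ αc)
    (hhr : ∀ v, ∑ u, Hk v u ≤ hr) (hlamA : ∀ x : κ, ∑ u, ∑ v, |A u x| * |A v x| * Hk v u ≤ lamA) (hlamA1 : lamA < 1)
    (hγ : αc * hr * αr / (1 - lamA) ≤ γ) (hγ1 : γ < 1) (hD : ∀ x y, 0 ≤ D x y)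
    (hDC : ∀ x y, (if x = y then (1 : ℝ) else 0) + ∑ z, D x z * ((if y = z then 0 else ∑ u, ∑ v, |A u y| * |A v z| * Hk v u) / (1 - lamA)) ≤ D x y)
    (hθnn : ∀ z w, 0 ≤ θ z w) (hDr : ∀ z, ∑ w, D z w * θ z w ≤ dθ) (hdθ : 0 ≤ dθ) (hDc : ∀ w, ∑ z, D z w * θ z w ≤ dθ') (hdθ' : 0 ≤ dθ')
    (hσ0 : ∀ x w, 0 ≤ σ x w) (hσθ : ∀ x z w, σ x w ≤ σ x z * θ z w) (hρ1 : ∀ x y, 1 ≤ ρ x y) (hρsymm : ∀ x y, ρ x y = ρ y x)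
    (hρmul : ∀ x y z, ρ x z ≤ ρ x y * ρ y z) (hρσ : ∀ x y w, ρ x y ^ 8 ≤ σ x w * σ y w) (haσ : ∀ v : ι, ∑ w, (∑ u, |A u w| * Hk v u) * σ v w ≤ αθ)
    (hβ : 0 ≤ βθ) (haσ' : ∀ (v : ι) (w : κ), (∑ u, |A u w| * Hk v u) * σ v w ≤ βθ) (hkσ : ∀ p q o : ι, ∑ w, (∑ u, |A u w| * K4 p q o u) * σ p w ≤ αθ)
    (hkσ' : ∀ (p q o : ι) (w : κ), (∑ u, |A u w| * K4 p q o u) * σ p w ≤ βθ)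
    (hK3 : ∀ (φ : EuclideanSpace ℝ ι) (u x y : ι), |U₃ φ (EuclideanSpace.single u (1 : ℝ)) (EuclideanSpace.single x (1 : ℝ)) (EuclideanSpace.single y
      (1 : ℝ))| ≤ K3 x y u)
    (hC3k : 4 * Real.sqrt ((5 * ((κ₂ ^ 4 + κ₄ ^ 4) * γop ^ 2) / (1 - lam * γop) ^ 2) * (αθ * dθ * (βθ * dθ') / (1 - lamA))) ≤ C3k) (x y z t s : ι) :
    |((∫ ω : EuclideanSpace ℝ ι, exp (-U (ω + ψ)) ∂(multivariateGaussian 0 (A * Aᵀ)))⁻¹ * (∫ ω : EuclideanSpace ℝ ι, exp (-U (ω + ψ)) * ((U' (ω + ψ)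
        (EuclideanSpace.single x (1 : ℝ)) - ((∫ ω : EuclideanSpace ℝ ι, exp (-U (ω + ψ)) ∂(multivariateGaussian 0 (A * Aᵀ)))⁻¹ * (∫ ω :
        EuclideanSpace ℝ ι, exp (-U (ω + ψ)) * U' (ω + ψ) (EuclideanSpace.single x (1 : ℝ)) ∂(multivariateGaussian 0 (A * Aᵀ))))) * (U₃ (ω + ψ)
        (EuclideanSpace.single y (1 : ℝ)) (EuclideanSpace.single z (1 : ℝ)) (EuclideanSpace.single t (1 : ℝ)) - ((∫ ω : EuclideanSpace ℝ ι, exp (-U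
        (ω + ψ)) ∂(multivariateGaussian 0 (A * Aᵀ)))⁻¹ * (∫ ω : EuclideanSpace ℝ ι, exp (-U (ω + ψ)) * U₃ (ω + ψ) (EuclideanSpace.single y (1 : ℝ))
        (EuclideanSpace.single z (1 : ℝ)) (EuclideanSpace.single t (1 : ℝ)) ∂(multivariateGaussian 0 (A * Aᵀ))))) * (U' (ω + ψ)
        (EuclideanSpace.single s (1 : ℝ)) - ((∫ ω : EuclideanSpace ℝ ι, exp (-U (ω + ψ)) ∂(multivariateGaussian 0 (A * Aᵀ)))⁻¹ * (∫ ω :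
        EuclideanSpace ℝ ι, exp (-U (ω + ψ)) * U' (ω + ψ) (EuclideanSpace.single s (1 : ℝ)) ∂(multivariateGaussian 0 (A * Aᵀ))))))
        ∂(multivariateGaussian 0 (A * Aᵀ))))| ≤
      if K3 z t y = 0 then 0 else C3k / (ρ x y * ρ x s) := by
  refine abs_le_ite_of_vanishing (((whitened_third_gradgrad_entry_two hΓop Y hUd hU'd hU''d hU₃d hU₄c hκ₀ hκ₁ ha hτ hδ hθ0 hθ1 hκθ hκθw hstab hU'b
      hU''b hU₃b hU₄b hlam hUsec hρg hHk hHk0 hK4 ψ hK40 hαr hαc hhr hlamA hlamA1 hγ hγ1 hD hDC hθnn hDr hdθ hDc hdθ' hσ0 hσθ hρ1 hρsymm hρmul hρσ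
      haσ hβ haσ' hkσ hkσ' x y z t s).trans
      (div_le_div_of_nonneg_right hC3k (mul_pos (by linarith [hρ1 x y]) (by linarith [hρ1 x s])).le))) ?_
  · intro h0
    have hv := fun φ => third_entry_vanishes hK3 (a := y) (b := z) (c := t) h0 φ
    simp [hv]

set_option maxHeartbeats 400000 in
/-- **`κ₃ᶜ(U″xy, U″zt, U′s)` with BOTH Hessian support indicators and the letter `C3h ≥ 4√(M_B K)`**: zero unless `y` is in `Hk`'s range of `x` and
`t` in that of `z`; else star decay from `x` to `z, s`. [folklore] -/
theorem hesshess_grad_entry_ite [Nonempty κ]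
    (hΓop : (γop • (1 : Matrix ι ι ℝ) - A * Aᵀ).PosSemidef) (Y : Finset ι) (hUd : ∀ φ : EuclideanSpace ℝ ι, HasFDerivAt U (U' φ) φ)
    (hU'd : ∀ φ : EuclideanSpace ℝ ι, HasFDerivAt U' (U'' φ) φ) (hU''d : ∀ φ : EuclideanSpace ℝ ι, HasFDerivAt U'' (U₃ φ) φ) (hU₃c : Continuous U₃)
    (hκ₀ : 0 ≤ κ₀) (hκ₁ : 0 ≤ κ₁) (ha : 0 ≤ a) (hτ : 0 < τ) (hδ : 0 < δ) (hθ0 : 0 < θp) (hθ1 : θp < 1) (hκθ : (2 * κ₀ * (1 + τ) + 4 * δ) * γop ≤ θp)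
    (hκθw : 2 * κ₀ * (1 + τ) * γop + 4 * δ ≤ θp) (hstab : ∀ φ : EuclideanSpace ℝ ι, -(κ₀ * ∑ x ∈ Y, φ x ^ 2) ≤ U φ)
    (hU'b : ∀ φ : EuclideanSpace ℝ ι, ‖U' φ‖ ≤ κ₁ * (a + ∑ x ∈ Y, φ x ^ 2)) (hU''b : ∀ φ : EuclideanSpace ℝ ι, ‖U'' φ‖ ≤ κ₂)
    (hU₃b : ∀ φ : EuclideanSpace ℝ ι, ‖U₃ φ‖ ≤ κ₃) (hlam : 0 ≤ lam)
    (hUsec : ∀ s : ℝ, 0 ≤ s → s ≤ 1 → ∀ a b : EuclideanSpace ℝ ι, U ((1 - s) • a + s • b) - lam / 2 * (s * (1 - s)) * ∑ i, (a i - b i) ^ 2 ≤ (1 - s) *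
      U a + s * U b)
    (hρg : lam * γop < 1)
    (hHk : ∀ (φ : EuclideanSpace ℝ ι) (x z : ι), |U'' φ (EuclideanSpace.single z (1 : ℝ)) (EuclideanSpace.single x (1 : ℝ))| ≤ Hk x z)
    (hHk0 : ∀ v u, 0 ≤ Hk v u)
    (hK3 : ∀ (φ : EuclideanSpace ℝ ι) (u x y : ι), |U₃ φ (EuclideanSpace.single u (1 : ℝ)) (EuclideanSpace.single x (1 : ℝ)) (EuclideanSpace.single y
      (1 : ℝ))| ≤ K3 x y u)
    (ψ : EuclideanSpace ℝ ι) (hK30 : ∀ x y u, 0 ≤ K3 x y u) (hαr : ∀ u, ∑ w, |A u w| ≤ αr) (hαc : ∀ w, ∑ u, |A u w| ≤ αc)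
    (hhr : ∀ v, ∑ u, Hk v u ≤ hr) (hlamA : ∀ x : κ, ∑ u, ∑ v, |A u x| * |A v x| * Hk v u ≤ lamA) (hlamA1 : lamA < 1)
    (hγ : αc * hr * αr / (1 - lamA) ≤ γ) (hγ1 : γ < 1) (hD : ∀ x y, 0 ≤ D x y)
    (hDC : ∀ x y, (if x = y then (1 : ℝ) else 0) + ∑ z, D x z * ((if y = z then 0 else ∑ u, ∑ v, |A u y| * |A v z| * Hk v u) / (1 - lamA)) ≤ D x y)
    (hθnn : ∀ z w, 0 ≤ θ z w) (hDr : ∀ z, ∑ w, D z w * θ z w ≤ dθ) (hdθ : 0 ≤ dθ) (hDc : ∀ w, ∑ z, D z w * θ z w ≤ dθ') (hdθ' : 0 ≤ dθ')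
    (hσ0 : ∀ x w, 0 ≤ σ x w) (hσθ : ∀ x z w, σ x w ≤ σ x z * θ z w) (hρ1 : ∀ x y, 1 ≤ ρ x y) (hρsymm : ∀ x y, ρ x y = ρ y x)
    (hρmul : ∀ x y z, ρ x z ≤ ρ x y * ρ y z) (hρσ : ∀ x y w, ρ x y ^ 8 ≤ σ x w * σ y w) (haσ : ∀ v : ι, ∑ w, (∑ u, |A u w| * Hk v u) * σ v w ≤ αθ)
    (hβ : 0 ≤ βθ) (haσ' : ∀ (v : ι) (w : κ), (∑ u, |A u w| * Hk v u) * σ v w ≤ βθ) (hgσ : ∀ p q : ι, ∑ w, (∑ u, |A u w| * K3 p q u) * σ p w ≤ αθ)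
    (hgσ' : ∀ (p q : ι) (w : κ), (∑ u, |A u w| * K3 p q u) * σ p w ≤ βθ)
    (hC3h : 4 * Real.sqrt ((5 * ((κ₂ ^ 4 + κ₃ ^ 4) * γop ^ 2) / (1 - lam * γop) ^ 2) * (αθ * dθ * (βθ * dθ') / (1 - lamA))) ≤ C3h) (x y z t s : ι) :
    |((∫ ω : EuclideanSpace ℝ ι, exp (-U (ω + ψ)) ∂(multivariateGaussian 0 (A * Aᵀ)))⁻¹ * (∫ ω : EuclideanSpace ℝ ι, exp (-U (ω + ψ)) * ((U'' (ω + ψ)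
        (EuclideanSpace.single x (1 : ℝ)) (EuclideanSpace.single y (1 : ℝ)) - ((∫ ω : EuclideanSpace ℝ ι, exp (-U (ω + ψ)) ∂(multivariateGaussian 0
        (A * Aᵀ)))⁻¹ * (∫ ω : EuclideanSpace ℝ ι, exp (-U (ω + ψ)) * U'' (ω + ψ) (EuclideanSpace.single x (1 : ℝ)) (EuclideanSpace.single y (1 : ℝ))
        ∂(multivariateGaussian 0 (A * Aᵀ))))) * (U'' (ω + ψ) (EuclideanSpace.single z (1 : ℝ)) (EuclideanSpace.single t (1 : ℝ)) - ((∫ ω :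
        EuclideanSpace ℝ ι, exp (-U (ω + ψ)) ∂(multivariateGaussian 0 (A * Aᵀ)))⁻¹ * (∫ ω : EuclideanSpace ℝ ι, exp (-U (ω + ψ)) * U'' (ω + ψ)
        (EuclideanSpace.single z (1 : ℝ)) (EuclideanSpace.single t (1 : ℝ)) ∂(multivariateGaussian 0 (A * Aᵀ))))) * (U' (ω + ψ)
        (EuclideanSpace.single s (1 : ℝ)) - ((∫ ω : EuclideanSpace ℝ ι, exp (-U (ω + ψ)) ∂(multivariateGaussian 0 (A * Aᵀ)))⁻¹ * (∫ ω :
        EuclideanSpace ℝ ι, exp (-U (ω + ψ)) * U' (ω + ψ) (EuclideanSpace.single s (1 : ℝ)) ∂(multivariateGaussian 0 (A * Aᵀ))))))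
        ∂(multivariateGaussian 0 (A * Aᵀ))))| ≤
      if Hk y x = 0 then 0 else if Hk t z = 0 then 0 else C3h / (ρ x z * ρ x s) := by
  refine abs_le_ite_of_vanishing (abs_le_ite_of_vanishing (((whitened_hesshess_grad_entry hΓop Y hUd hU'd hU''d hU₃c hκ₀ hκ₁ ha hτ hδ hθ0 hθ1 hκθ
      hκθw hstab hU'b hU''b hU₃b hlam hUsec hρg hHk hHk0 hK3 ψ hK30 hαr hαc hhr hlamA hlamA1 hγ hγ1 hD hDC hθnn hDr hdθ hDc hdθ' hσ0 hσθ hρ1 hρsymm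
      hρmul hρσ haσ hβ haσ' hgσ hgσ' x y z t s).trans
      (div_le_div_of_nonneg_right hC3h (mul_pos (by linarith [hρ1 x z]) (by linarith [hρ1 x s])).le))) ?_) ?_
  · intro h0
    have hv := fun φ => hessian_entry_vanishes hHk (a := z) (b := t) h0 φ
    simp [hv]
  · intro h0
    have hv := fun φ => hessian_entry_vanishes hHk (a := x) (b := y) h0 φ
    simp [hv]

set_option maxHeartbeats 400000 in
/-- **`κ₃ᶜ(U′x, U″yz, U″ts)` with both Hessian support indicators and the letter `C3h`**: zero unless `z` is in the range of `y` and `s` in that of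
`t`; else star decay from `x` to `y, t`. [folklore] -/
theorem hesshess_grad_entry_two_ite [Nonempty κ]
    (hΓop : (γop • (1 : Matrix ι ι ℝ) - A * Aᵀ).PosSemidef) (Y : Finset ι) (hUd : ∀ φ : EuclideanSpace ℝ ι, HasFDerivAt U (U' φ) φ)
    (hU'd : ∀ φ : EuclideanSpace ℝ ι, HasFDerivAt U' (U'' φ) φ) (hU''d : ∀ φ : EuclideanSpace ℝ ι, HasFDerivAt U'' (U₃ φ) φ) (hU₃c : Continuous U₃)
    (hκ₀ : 0 ≤ κ₀) (hκ₁ : 0 ≤ κ₁) (ha : 0 ≤ a) (hτ : 0 < τ) (hδ : 0 < δ) (hθ0 : 0 < θp) (hθ1 : θp < 1) (hκθ : (2 * κ₀ * (1 + τ) + 4 * δ) * γop ≤ θp)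
    (hκθw : 2 * κ₀ * (1 + τ) * γop + 4 * δ ≤ θp) (hstab : ∀ φ : EuclideanSpace ℝ ι, -(κ₀ * ∑ x ∈ Y, φ x ^ 2) ≤ U φ)
    (hU'b : ∀ φ : EuclideanSpace ℝ ι, ‖U' φ‖ ≤ κ₁ * (a + ∑ x ∈ Y, φ x ^ 2)) (hU''b : ∀ φ : EuclideanSpace ℝ ι, ‖U'' φ‖ ≤ κ₂)
    (hU₃b : ∀ φ : EuclideanSpace ℝ ι, ‖U₃ φ‖ ≤ κ₃) (hlam : 0 ≤ lam)
    (hUsec : ∀ s : ℝ, 0 ≤ s → s ≤ 1 → ∀ a b : EuclideanSpace ℝ ι, U ((1 - s) • a + s • b) - lam / 2 * (s * (1 - s)) * ∑ i, (a i - b i) ^ 2 ≤ (1 - s) *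
      U a + s * U b)
    (hρg : lam * γop < 1)
    (hHk : ∀ (φ : EuclideanSpace ℝ ι) (x z : ι), |U'' φ (EuclideanSpace.single z (1 : ℝ)) (EuclideanSpace.single x (1 : ℝ))| ≤ Hk x z)
    (hHk0 : ∀ v u, 0 ≤ Hk v u)
    (hK3 : ∀ (φ : EuclideanSpace ℝ ι) (u x y : ι), |U₃ φ (EuclideanSpace.single u (1 : ℝ)) (EuclideanSpace.single x (1 : ℝ)) (EuclideanSpace.single y
      (1 : ℝ))| ≤ K3 x y u)
    (ψ : EuclideanSpace ℝ ι) (hK30 : ∀ x y u, 0 ≤ K3 x y u) (hαr : ∀ u, ∑ w, |A u w| ≤ αr) (hαc : ∀ w, ∑ u, |A u w| ≤ αc)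
    (hhr : ∀ v, ∑ u, Hk v u ≤ hr) (hlamA : ∀ x : κ, ∑ u, ∑ v, |A u x| * |A v x| * Hk v u ≤ lamA) (hlamA1 : lamA < 1)
    (hγ : αc * hr * αr / (1 - lamA) ≤ γ) (hγ1 : γ < 1) (hD : ∀ x y, 0 ≤ D x y)
    (hDC : ∀ x y, (if x = y then (1 : ℝ) else 0) + ∑ z, D x z * ((if y = z then 0 else ∑ u, ∑ v, |A u y| * |A v z| * Hk v u) / (1 - lamA)) ≤ D x y)
    (hθnn : ∀ z w, 0 ≤ θ z w) (hDr : ∀ z, ∑ w, D z w * θ z w ≤ dθ) (hdθ : 0 ≤ dθ) (hDc : ∀ w, ∑ z, D z w * θ z w ≤ dθ') (hdθ' : 0 ≤ dθ')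
    (hσ0 : ∀ x w, 0 ≤ σ x w) (hσθ : ∀ x z w, σ x w ≤ σ x z * θ z w) (hρ1 : ∀ x y, 1 ≤ ρ x y) (hρsymm : ∀ x y, ρ x y = ρ y x)
    (hρmul : ∀ x y z, ρ x z ≤ ρ x y * ρ y z) (hρσ : ∀ x y w, ρ x y ^ 8 ≤ σ x w * σ y w) (haσ : ∀ v : ι, ∑ w, (∑ u, |A u w| * Hk v u) * σ v w ≤ αθ)
    (hβ : 0 ≤ βθ) (haσ' : ∀ (v : ι) (w : κ), (∑ u, |A u w| * Hk v u) * σ v w ≤ βθ) (hgσ : ∀ p q : ι, ∑ w, (∑ u, |A u w| * K3 p q u) * σ p w ≤ αθ)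
    (hgσ' : ∀ (p q : ι) (w : κ), (∑ u, |A u w| * K3 p q u) * σ p w ≤ βθ)
    (hC3h : 4 * Real.sqrt ((5 * ((κ₂ ^ 4 + κ₃ ^ 4) * γop ^ 2) / (1 - lam * γop) ^ 2) * (αθ * dθ * (βθ * dθ') / (1 - lamA))) ≤ C3h) (x y z t s : ι) :
    |((∫ ω : EuclideanSpace ℝ ι, exp (-U (ω + ψ)) ∂(multivariateGaussian 0 (A * Aᵀ)))⁻¹ * (∫ ω : EuclideanSpace ℝ ι, exp (-U (ω + ψ)) * ((U' (ω + ψ)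
        (EuclideanSpace.single x (1 : ℝ)) - ((∫ ω : EuclideanSpace ℝ ι, exp (-U (ω + ψ)) ∂(multivariateGaussian 0 (A * Aᵀ)))⁻¹ * (∫ ω :
        EuclideanSpace ℝ ι, exp (-U (ω + ψ)) * U' (ω + ψ) (EuclideanSpace.single x (1 : ℝ)) ∂(multivariateGaussian 0 (A * Aᵀ))))) * (U'' (ω + ψ)
        (EuclideanSpace.single y (1 : ℝ)) (EuclideanSpace.single z (1 : ℝ)) - ((∫ ω : EuclideanSpace ℝ ι, exp (-U (ω + ψ)) ∂(multivariateGaussian 0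
        (A * Aᵀ)))⁻¹ * (∫ ω : EuclideanSpace ℝ ι, exp (-U (ω + ψ)) * U'' (ω + ψ) (EuclideanSpace.single y (1 : ℝ)) (EuclideanSpace.single z (1 : ℝ))
        ∂(multivariateGaussian 0 (A * Aᵀ))))) * (U'' (ω + ψ) (EuclideanSpace.single t (1 : ℝ)) (EuclideanSpace.single s (1 : ℝ)) - ((∫ ω :
        EuclideanSpace ℝ ι, exp (-U (ω + ψ)) ∂(multivariateGaussian 0 (A * Aᵀ)))⁻¹ * (∫ ω : EuclideanSpace ℝ ι, exp (-U (ω + ψ)) * U'' (ω + ψ)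
        (EuclideanSpace.single t (1 : ℝ)) (EuclideanSpace.single s (1 : ℝ)) ∂(multivariateGaussian 0 (A * Aᵀ)))))) ∂(multivariateGaussian 0 (A *
        Aᵀ))))| ≤
      if Hk z y = 0 then 0 else if Hk s t = 0 then 0 else C3h / (ρ x y * ρ x t) := by
  refine abs_le_ite_of_vanishing (abs_le_ite_of_vanishing (((whitened_hesshess_grad_entry_two hΓop Y hUd hU'd hU''d hU₃c hκ₀ hκ₁ ha hτ hδ hθ0 hθ1 hκθ
      hκθw hstab hU'b hU''b hU₃b hlam hUsec hρg hHk hHk0 hK3 ψ hK30 hαr hαc hhr hlamA hlamA1 hγ hγ1 hD hDC hθnn hDr hdθ hDc hdθ' hσ0 hσθ hρ1 hρsymm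
      hρmul hρσ haσ hβ haσ' hgσ hgσ' x y z t s).trans
      (div_le_div_of_nonneg_right hC3h (mul_pos (by linarith [hρ1 x y]) (by linarith [hρ1 x t])).le))) ?_) ?_
  · intro h0
    have hv := fun φ => hessian_entry_vanishes hHk (a := t) (b := s) h0 φ
    simp [hv]
  · intro h0
    have hv := fun φ => hessian_entry_vanishes hHk (a := y) (b := z) h0 φ
    simp [hv]

/-! ## §3. Toy -/

/-- Toy (the indicator mechanism): a bound `B` improves to `0` on the vanishing set. -/
example (v B c : ℝ) (h : |v| ≤ B) (h0 : c = 0 → v = 0) : |v| ≤ (if c = 0 then (0 : ℝ) else B) := abs_le_ite_of_vanishing h h0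

end Summit.QuantumFields.BalabanUV.T4Continuum.NE7b.SupFifthKernelEntryPieces

end
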